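import Literature.NumberTheory.ComplexMultiplication.CMOrderWeakClassesGoodRepresentatives
import Literature.NumberTheory.ComplexMultiplication.CMOrderGorenstein
import HarnessLib

/-!
# Representatives when `RᵗT` is invertible in `T` (MARSEGLIA 2025 COROLLARY 6.4): then `I₀T` is weakly equivalent
# to `T` for every `I₀` with `(I₀:I₀) = R`, so `I₀` is weakly equivalent to some `I = L₀I₀` with `IT = T` and
# `(R:T) ⊆ I ⊆ T` — for `T = (𝔭:𝔭)`: `𝔭 = 𝔭I ⊆ I ⊆ T`

Family `hodge`, lane `lit-hodgefound` (Track 2 foundations library; seat p15, row g26-#14), topic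
`Literature/NumberTheory/ComplexMultiplication`, namespaces `Literature.NumberTheory.ComplexMultiplication.EndOrder`
(§1, any order `𝔯 = endOrder ρ`) and `…CMTypeLattice` (§2, `𝔯 = endOrder (M_μ)` with trace duals as in
`CMOrderGorenstein`: `↑T₁ = traceDual ℤ ℚ ↑(1 : FractionalIdeal _ K)` says «`T₁ = Rᵗ`», `↑TI = traceDual ℤ ℚ ↑I₀` says
«`TI = I₀ᵗ`»).  THEOREMS ONLY: no definition, no instance, no named fact (net Literature debt `0`).  Vocabulary:
`(I:J) = I / J`, an over-order is an idempotent `M = MM ≠ 0`, `IT` is `I * M`, «`N` invertible as a fractional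
`T`-ideal» is `∃ N′, N·N′ = T`, weak equivalence is `1 ∈ (I:J)(J:I)`, `(𝔭:𝔭) = ↑𝔭 / ↑𝔭`.

## Source, VERBATIM

S. Marseglia, *Local isomorphism classes of fractional ideals of orders in étale algebras*, J. Algebra 673 (2025)
77–102 [Marseglia2025LocalIsomorphism] (arXiv:2311.18571, held `paper:arxiv-2311.18571`, chunk p0011):
"Corollary 6.4. Let `R`, `𝔭`, `T` and `I₀` be as in Theorem 6.3. Assume that `R^tT` is invertible as a fractional
`T`-ideal. Then there exist a fractional `R`-ideal `I` and a unique index `i` such that `I` and `I₀` are weakly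
equivalent, `IT = T`, and `𝔭I = 𝔭 ⊆ I ⊆ T`. Moreover, for such `I` we have that the natural inclusion `I ⊆ T` induces
an inclusion `I/𝔭I ↪ T/𝔭` of `R/𝔭`-vector spaces.  Proof. Since `I₀^tI₀ = R^t` by Lemma 2.1, we get that `I₀T` is
also invertible as a fractional `T`-ideal, that is, `I₀T` is weakly equivalent to `T`. Hence the result follows from
Theorem 6.3, by considering only the invertible class of `W̄(T)` and representing it by `T`. □"

## What is formalised

* §1: **`EndOrder.one_mem_div_mul_div_of_mul_mul_eq`** (`A·X = T` for `T`-modules `A`, `X` ⟹ `1 ∈ (T:A)(A:T)`: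
  «invertible as a fractional `T`-ideal, that is, weakly equivalent to `T`»).
* §2: **`CMTypeLattice.mul_mul_mul_mul_eq_of_div_self_eq_one`** (`(I₀T)(I₀ᵗT) = RᵗT` when `(I₀:I₀) = R`, Lemma 2.1),
  **`exists_mul_mul_eq_of_div_self_eq_one`** (`RᵗT` invertible in `T` ⟹ `I₀T` invertible in `T`),
  **`one_mem_div_mul_div_mul_of_div_self_eq_one`** (`I₀T` is weakly equivalent to `T`),
  **`exists_one_div_mul_le_of_div_self_eq_one`** (COR. 6.4 for any over-order `T`: `I ~ I₀`, `I = L₀I₀`, `IT = T`,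
  `(R:T) ⊆ I ⊆ T`), **`exists_coeIdeal_le_of_div_self_eq_one`** (COR. 6.4 as printed, `T = (𝔭:𝔭)`:
  `𝔭 ⊆ I ⊆ T`, `𝔭I = 𝔭`).
-/

noncomputable section

open scoped nonZeroDivisors NumberField
open NumberField Module FractionalIdeal
open Submodule (traceDual)

namespace Literature.NumberTheory.ComplexMultiplication

/-! ## §1 «invertible as a fractional `T`-ideal, that is, weakly equivalent to `T`» -/

namespace EndOrder

variable {K : Type} [Field K] [NumberField K]
variable {ι : Type} [Fintype ι] [DecidableEq ι] {ρ : K →ₐ[ℚ] Matrix ι ι ℚ}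
variable [IsFractionRing (endOrder ρ) K]

/-- **An ideal invertible in the over-order `T` is weakly equivalent to `T`**: if `TA = A` and `A·X = T ∋ 1` then
`1 ∈ (T:A)(A:T)` (`X ⊆ (T:A)`, `A ⊆ (A:T)`). [cite: Marseglia2025LocalIsomorphism, §6, proof of Cor. 6.4 («`I₀T` is
also invertible as a fractional `T`-ideal, that is, `I₀T` is weakly equivalent to `T`»), p. 11]
[cite: Marseglia2019, §4 (after Def. 4.2: «an ideal is invertible if and only if it is weakly equivalent to its
multiplicator ring»), p. 8] -/
theorem one_mem_div_mul_div_of_mul_mul_eq {T A X : FractionalIdeal (endOrder ρ)⁰ K} (hT0 : T ≠ 0) (hA0 : A ≠ 0)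
    (h1 : (1 : K) ∈ T) (hTA : T * A = A) (hAX : A * X = T) : (1 : K) ∈ T / A * (A / T) := by
  have hX : X ≤ T / A := (le_div_iff_mul_le hA0).2 (by rw [mul_comm, hAX])
  have hA : A ≤ A / T := (le_div_iff_mul_le hT0).2 (by rw [mul_comm, hTA])
  have h : (1 : K) ∈ X * A := by rw [mul_comm, hAX]; exact h1
  exact mul_le_mul' hX hA h

end EndOrder

/-! ## §2 Corollary 6.4 for the order `𝔯 = endOrder (M_μ)` -/

namespace CMTypeLattice

variable {K : Type} [Field K] [NumberField K]
variable {ι : Type} [Fintype ι] [DecidableEq ι] [Nonempty ι] (μ : Basis ι ℚ K)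
variable [IsFractionRing (endOrder (Algebra.leftMulMatrix μ)) K]

omit [Nonempty ι] in
/-- **«Since `I₀ᵗI₀ = Rᵗ` by Lemma 2.1»: `(I₀T)(I₀ᵗT) = RᵗT`** for `(I₀:I₀) = R` and an over-order `T = M` (`↑TI = I₀ᵗ`,
`↑T₁ = Rᵗ`). [cite: Marseglia2025LocalIsomorphism, §6, proof of Cor. 6.4, p. 11] [cite: Marseglia2019, §2 Lemma 2.3
(«`S = (I:I) ⟺ IIᵗ = Sᵗ`»), p. 4] -/
theorem mul_mul_mul_mul_eq_of_div_self_eq_one {I₀ TI T₁ M : FractionalIdeal (endOrder (Algebra.leftMulMatrix μ))⁰ K}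
    (hMM : M * M = M) (hI₀ : I₀ ≠ 0) (hTI0 : TI ≠ 0) (hII : I₀ / I₀ = 1)
    (hTI : (TI : Submodule (endOrder (Algebra.leftMulMatrix μ)) K) =
      traceDual ℤ ℚ (I₀ : Submodule (endOrder (Algebra.leftMulMatrix μ)) K))
    (hT₁ : (T₁ : Submodule (endOrder (Algebra.leftMulMatrix μ)) K) =
      traceDual ℤ ℚ ((1 : FractionalIdeal (endOrder (Algebra.leftMulMatrix μ))⁰ K) :
        Submodule (endOrder (Algebra.leftMulMatrix μ)) K)) :
    I₀ * M * (TI * M) = T₁ * M := by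
  have h10 : (1 : FractionalIdeal (endOrder (Algebra.leftMulMatrix μ))⁰ K) ≠ 0 := one_ne_zero
  have hITI : I₀ * TI = T₁ := (div_self_eq_iff_mul_traceDual_eq μ hI₀ hTI0 h10 hTI hT₁).1 hII
  rw [mul_mul_mul_comm, hITI, hMM]

omit [Nonempty ι] in
/-- **`RᵗT` invertible in `T` ⟹ `I₀T` invertible in `T`** for every `I₀` with `(I₀:I₀) = R`:
`(I₀T)·(I₀ᵗT·N′) = RᵗT·N′ = T`. [cite: Marseglia2025LocalIsomorphism, §6, proof of Cor. 6.4, p. 11] -/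
theorem exists_mul_mul_eq_of_div_self_eq_one {I₀ T₁ M : FractionalIdeal (endOrder (Algebra.leftMulMatrix μ))⁰ K}
    (hMM : M * M = M) (hI₀ : I₀ ≠ 0) (hII : I₀ / I₀ = 1)
    (hT₁ : (T₁ : Submodule (endOrder (Algebra.leftMulMatrix μ)) K) =
      traceDual ℤ ℚ ((1 : FractionalIdeal (endOrder (Algebra.leftMulMatrix μ))⁰ K) :
        Submodule (endOrder (Algebra.leftMulMatrix μ)) K))
    (hinv : ∃ N' : FractionalIdeal (endOrder (Algebra.leftMulMatrix μ))⁰ K, T₁ * M * N' = M) :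
    ∃ X : FractionalIdeal (endOrder (Algebra.leftMulMatrix μ))⁰ K, I₀ * M * X = M := by
  obtain ⟨TI, hTI0, hTI⟩ := exists_coe_eq_traceDual μ hI₀
  obtain ⟨N', hN'⟩ := hinv
  refine ⟨TI * M * N', ?_⟩
  rw [← mul_assoc, mul_mul_mul_mul_eq_of_div_self_eq_one μ hMM hI₀ hTI0 hII hTI hT₁, hN']

/-- **«that is, `I₀T` is weakly equivalent to `T`»: `1 ∈ (T : I₀T)(I₀T : T)`** when `RᵗT` is invertible in the
over-order `T = M` and `(I₀:I₀) = R`. [cite: Marseglia2025LocalIsomorphism, §6, proof of Cor. 6.4, p. 11] -/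
theorem one_mem_div_mul_div_mul_of_div_self_eq_one {I₀ T₁ M : FractionalIdeal (endOrder (Algebra.leftMulMatrix μ))⁰ K}
    (hMM : M * M = M) (hM0 : M ≠ 0) (hI₀ : I₀ ≠ 0) (hII : I₀ / I₀ = 1)
    (hT₁ : (T₁ : Submodule (endOrder (Algebra.leftMulMatrix μ)) K) =
      traceDual ℤ ℚ ((1 : FractionalIdeal (endOrder (Algebra.leftMulMatrix μ))⁰ K) :
        Submodule (endOrder (Algebra.leftMulMatrix μ)) K))
    (hinv : ∃ N' : FractionalIdeal (endOrder (Algebra.leftMulMatrix μ))⁰ K, T₁ * M * N' = M) :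
    (1 : K) ∈ M / (I₀ * M) * (I₀ * M / M) := by
  obtain ⟨X, hX⟩ := exists_mul_mul_eq_of_div_self_eq_one μ hMM hI₀ hII hT₁ hinv
  exact EndOrder.one_mem_div_mul_div_of_mul_mul_eq hM0 (EndOrder.fractionalIdeal_mul_ne_zero hI₀ hM0)
    (FractionalIdeal.one_le.1 (EndOrder.one_le_of_mul_self_eq hMM hM0)) (by rw [mul_left_comm, hMM]) hX

/-- **COROLLARY 6.4 for any over-order `T` with `RᵗT` invertible in `T`: every `I₀` with `(I₀:I₀) = R` is weakly
equivalent to some `I = L₀I₀` (`L₀ ∈ 𝓘(𝔯)`) with `IT = T` and `(R:T) ⊆ I ⊆ T`** (Prop. 6.2 with the invertible class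
of `W̄(T)` represented by `T`). [cite: Marseglia2025LocalIsomorphism, §6 Cor. 6.4 with Prop. 6.2, p. 11] -/
theorem exists_one_div_le_of_div_self_eq_one {I₀ T₁ M : FractionalIdeal (endOrder (Algebra.leftMulMatrix μ))⁰ K}
    (hMM : M * M = M) (hM0 : M ≠ 0) (hI₀ : I₀ ≠ 0) (hII : I₀ / I₀ = 1)
    (hT₁ : (T₁ : Submodule (endOrder (Algebra.leftMulMatrix μ)) K) =
      traceDual ℤ ℚ ((1 : FractionalIdeal (endOrder (Algebra.leftMulMatrix μ))⁰ K) :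
        Submodule (endOrder (Algebra.leftMulMatrix μ)) K))
    (hinv : ∃ N' : FractionalIdeal (endOrder (Algebra.leftMulMatrix μ))⁰ K, T₁ * M * N' = M) :
    ∃ I : FractionalIdeal (endOrder (Algebra.leftMulMatrix μ))⁰ K,
      (∃ L₀ : FractionalIdeal (endOrder (Algebra.leftMulMatrix μ))⁰ K, IsUnit L₀ ∧ I = L₀ * I₀) ∧
      (1 : K) ∈ I / I₀ * (I₀ / I) ∧ I * M = M ∧ 1 / M ≤ I ∧ I ≤ M := by
  obtain ⟨I, hL, hw, hIM, hfI, hIM'⟩ := exists_one_div_mul_le_of_one_mem μ hMM hM0 hI₀ hM0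
    (one_mem_div_mul_div_mul_of_div_self_eq_one μ hMM hM0 hI₀ hII hT₁ hinv)
  refine ⟨I, hL, hw, hIM, le_trans (le_of_eq ?_) hfI, hIM'⟩
  rw [mul_comm, EndOrder.mul_one_div_eq_of_mul_self_eq hMM hM0]

/-- **COROLLARY 6.4 (as printed, `T = (𝔭:𝔭)`): if `Rᵗ(𝔭:𝔭)` is invertible in `(𝔭:𝔭)`, every `I₀` with `(I₀:I₀) = R`
is weakly equivalent to some `I = L₀I₀` (`L₀ ∈ 𝓘(𝔯)`) with `I·(𝔭:𝔭) = (𝔭:𝔭)` and `𝔭 ⊆ I ⊆ (𝔭:𝔭)`, `𝔭I = 𝔭`** (so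
`I/𝔭I ↪ T/𝔭`). [cite: Marseglia2025LocalIsomorphism, §6 Cor. 6.4, p. 11] -/
theorem exists_coeIdeal_le_of_div_self_eq_one (𝔭 : Ideal (endOrder (Algebra.leftMulMatrix μ))) [h𝔭 : 𝔭.IsMaximal]
    {I₀ T₁ : FractionalIdeal (endOrder (Algebra.leftMulMatrix μ))⁰ K} (hI₀ : I₀ ≠ 0) (hII : I₀ / I₀ = 1)
    (hT₁ : (T₁ : Submodule (endOrder (Algebra.leftMulMatrix μ)) K) =
      traceDual ℤ ℚ ((1 : FractionalIdeal (endOrder (Algebra.leftMulMatrix μ))⁰ K) :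
        Submodule (endOrder (Algebra.leftMulMatrix μ)) K))
    (hinv : ∃ N' : FractionalIdeal (endOrder (Algebra.leftMulMatrix μ))⁰ K,
      T₁ * ((𝔭 : FractionalIdeal (endOrder (Algebra.leftMulMatrix μ))⁰ K) / 𝔭) * N' =
        (𝔭 : FractionalIdeal (endOrder (Algebra.leftMulMatrix μ))⁰ K) / 𝔭) :
    ∃ I : FractionalIdeal (endOrder (Algebra.leftMulMatrix μ))⁰ K,
      (∃ L₀ : FractionalIdeal (endOrder (Algebra.leftMulMatrix μ))⁰ K, IsUnit L₀ ∧ I = L₀ * I₀) ∧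
      (1 : K) ∈ I / I₀ * (I₀ / I) ∧ I * ((𝔭 : FractionalIdeal (endOrder (Algebra.leftMulMatrix μ))⁰ K) / 𝔭) =
        (𝔭 : FractionalIdeal (endOrder (Algebra.leftMulMatrix μ))⁰ K) / 𝔭 ∧
      (𝔭 : FractionalIdeal (endOrder (Algebra.leftMulMatrix μ))⁰ K) ≤ I ∧
      I ≤ (𝔭 : FractionalIdeal (endOrder (Algebra.leftMulMatrix μ))⁰ K) / 𝔭 ∧
      (𝔭 : FractionalIdeal (endOrder (Algebra.leftMulMatrix μ))⁰ K) * I = 𝔭 := by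
  have h0 : 𝔭 ≠ ⊥ := Ring.ne_bot_of_isMaximal_of_not_isField h𝔭 EndOrder.not_isField
  have hP0 : (𝔭 : FractionalIdeal (endOrder (Algebra.leftMulMatrix μ))⁰ K) ≠ 0 := coeIdeal_ne_zero.2 h0
  have hT0 := EndOrder.div_self_ne_zero hP0
  have hTT := EndOrder.div_self_mul_div_self hP0
  obtain ⟨I, hL, hw, hIT, h𝔭J, hIJ, h𝔭I⟩ := exists_coeIdeal_mul_le_of_one_mem μ 𝔭 hI₀ hT0
    (one_mem_div_mul_div_mul_of_div_self_eq_one μ hTT hT0 hI₀ hII hT₁ hinv)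
  rw [EndOrder.mul_div_self_eq_self hP0] at h𝔭J h𝔭I
  exact ⟨I, hL, hw, hIT, h𝔭J, hIJ, h𝔭I⟩

end CMTypeLattice

end Literature.NumberTheory.ComplexMultiplication
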